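import Literature.MathematicalPhysics.QuantumFieldTheory.Balaban1983to89.Node00.Record13DatumKeyCoP
import Summits.QuantumFields.YangMills.Theorems.BalabanUVNodesRateCarriersOfRecord13
import Summits.QuantumFields.YangMills.Theorems.BalabanUVNodesRateCarriersOfRecord12
import Literature.MathematicalPhysics.QuantumFieldTheory.Balaban1983to89.Node00.Record13DatumKey

/-!
# ⁗ (SEPARATION-GUARD) EDITION of 1″ `BalabanUVNodesRateCarriersOfRecord13` (p493463) — THE (T-RATE) LAYER B — the rate-carrier predicate of record `RRec₁₃CoP 𝔯`, readings `RateReading₁₃CoP` TAKING `hP : θ.Provisos₁₃Core F N`, bundles `rateCarriersOfRecord₁₃CoP`, keyed by RR-2's `IsDatumOfRecord₁₃CCoP`.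
#
# WHY THIS FILE EXISTS (route `route-QuantumFields-BalabanUVNodes` rev 18; director-ym LINE №136–№138, plan g67 ACK-138, dag-lead WORDS-139∕140, pub-ymgap INBOX
# l.16256 ∕ l.16518 ∕ l.16567 ∕ l.16541).  def-P11 LOCATED that `Stage13Params.Provisos₁₃.bg` demanded the background-row conclusion at EVERY (2.18)-sequence, where
# print ([Balaban1989LargeFieldII] Thm 1) gives it only at SEPARATED sequences; the gate refuses a same-name in-place body change (D-0009), so def-T's `Node00/Record13`
# v1.2 (p501191) ADDED the print-faithful proviso `Stage13Params.Provisos₁₃Core` (support guard via `Sect2.SeqSeparated`) with its datum `Node00.datumOfRecord₁₃CoP` (`= datumOfRecord₁₃`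
# on the old provisos by `rfl`), RR-2 re-keyed the datum key (`Node00/Record13DatumKeyCoP`, p521571: `IsDatumOfRecord₁₃CCoP ∕ COn ∕ CN`, `IsRecordOfRecord₁₃CCoP…`), and the four
# cruxes were re-minted ⁗ over the new tokens (K3⁗ `SpineGivenEndpointR13Sep`).  A proof of the WEAKER new proviso cannot feed a theorem binding the old one, so every
# storey typed `∀ θ (hP : θ.Provisos₁₃ F N), …` is re-keyed ONCE; this file is the (T-RATE) pen's twin of its own ‴ module under the token map
# `Provisos₁₃ ↦ Provisos₁₃Core` · `datumOfRecord₁₃ ↦ datumOfRecord₁₃CoP` · `(Is|is)DatumOfRecord₁₃C… ↦ …₁₃CCoP…` · `(Is|is)RecordOfRecord₁₃C… ↦ …₁₃CCoP…` and, for THIS seat's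
# names, `₁₃ ↦ ₁₃CoP` inserted in the stage-KEYED stems only (`RateReading₁₃`, `rateCarriersOfRecord₁₃`, `RRec₁₃(On)`, `rRec₁₃…`, `readingOfRecord₁₃`, `…datumKey₁₃…`,
# `n22_tupleReadingOfRecord(On)…`).  EVERYTHING θ-LEVEL IS UNCHANGED AND NOT RE-DECLARED: `Stage13Params`, `u3OfRecord₁₃ θ u k` and its faces, the θ-form slot ∕ edge
# closers `n22At_u3OfRecord₁₃_…` of the ‴ modules carry no proviso and are IMPORTED BY NAME (this module imports its ‴ original) — here: `u3OfRecord₁₃`, `u3OfRecord₁₃_W`, `u3OfRecord₁₃_γ`, `u3OfRecord₁₃_C`, `u3OfRecord₁₃_EA`, `u3OfRecord₁₃_EB`, `u3OfRecord₁₃_Λ`, `u3OfRecord₁₃_eq_u3OfRecord₁₂`, `u3OfRecord₁₃_eq_toStage11`, `fadingMemory_u3OfRecord₁₃`, `n22At_u3OfRecord₁₃_iff`, `u3OfRecord₁₃_objects`.  Statements = the ‴ statements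
# under the map, proofs = the ‴ proofs verbatim (kernel re-derivations BY NAME); the ‴ module stays in the tree as the aside items' context.  bg-BLIND: like its
# original, nothing here reads any field of the proviso — it enters only as the binder TYPE of the readings and through RR-2's key.
#
# ITEM IDS: crux names ∕ item ids quoted in the ‴ header below (K0‴–K3‴ = stmt-QuantumFields-19909…19912, `Record13Inhabited`, `SpineGivenEndpointR13`) are the
# rev-16∕17 ones, ASIDES after rev 18; this file is filed `--supports stmt-QuantumFields-20292` (K3⁗ `SpineGivenEndpointR13Sep` per plan's KEY line ∕ dag-lead WORDS-140) as a HELPER —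
# count-neutral, no stub closed, N22 NOT discharged, no inhabitant of any ⁗ key claimed (K0⁗ `Record13SepInhabited` OPEN).
#
# ‴ HEADER OF RECORD FOLLOWS (token-mapped; its decl lists are this file's, the θ-only names above excepted):
#
# THE RATE-CARRIER PREDICATE OF RECORD AT NODE 00's STAGE 13 — layer B of the RATE-RECORD HOME at `Record13`: `YMDAG.UVSplit.RRec₁₃CoP 𝔯 : RateRecordPred N`,
# KEYED BY THE DATUM (`Node00.IsDatumOfRecord₁₃CCoP F N D`, canonical parameter `h.params` with its provisos `h.provisos`) to the rate objects of layer A read at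
# def-T's `Stage13Params` (`Node00/Record13` v1.1, p488788): the bundle of run length `k` at `(F, D, g₀, os)` IS `rateCarriersOfRecord₁₃CoP 𝔯 F h.params h.provisos g₀ os k`;
# the ONE-APPLICATION faces of the K4 stubs `S_N14 … S_N22`, `S_D4`, `S_R00x` and K4's hooks `RateInputs ∕ RateInputsAll` at the Stage-13 home

Track A of `YM-PLAN.md` (cell `pub-ymgap`, HUMAN RULING D-0062).  The (T-RATE) pen's own re-key `12 ↦ 13` of layer B `…RateCarriersOfRecord12.lean` (p466281), on the
fired trigger «a further record re-pin ⇒ re-key of the home»: director-ym LINE №125 «RECORD 13» ∕ №133 (route `route-QuantumFields-BalabanUVNodes` rev 16 ∕ 17: the four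
cruxes K0‴ `Record13Inhabited` ∕ K1‴ `StabilityBAtRecordR13e` ∕ K2‴ `EndpointGivenBR13` ∕ K3‴ `SpineGivenEndpointR13` are typed over `Node00.Stage13Params F 2` on
`Node00/Record13` v1.1), dag-lead KEY TABLE WORDS-133 ∕ WORDS-134, and the consumers' stand-in evidence (dag-n16-e g5 pub-ymgap INBOX l.15874: the pure token twin of this
seat's two Stage-12 layer-B files elaborates against `Node00/Record13` + `Node00/Record13DatumKey` as landed).  WHY A RE-KEY (def-T, `Node00/Record13` header; RR-2,
`Node00/Record13DatumKey` «WHAT IS NOT HERE»): the Stage-13 record is RE-BASED (canonical-version transport, the (2.9)-species small-field width `ε₂₉`, the located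
over-reaching fields of `Provisos₁₂` re-pointed), its histories differ from Stage 12's, and there is NO `₁₂ ↔ ₁₃` key bridge — so every Stage-12 home statement stands as it
is and the K4 content of the NE-side at the record OF RECORD is read at THIS home.  Definition lane (one `structure`, three `def`s); every theorem is kernel bookkeeping over
tree declarations BY NAME; 0 `sorry`, standard axioms.  COUNT-NEUTRAL; `--supports` the K3‴ item (stmt-QuantumFields-19912 `SpineGivenEndpointR13`).  Restate-immune
(no Theses import); NOTHING landed is edited or re-declared (layer B at ₁₁ ∕ ₁₂ — p457330 ∕ p466281 — and their certificates stay where they are).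

IMPORTS.  Layer B at ₁₂ (p466281: brings layer B at ₁₁ p457330 with its STAGE-FREE `towerData₁₁ ∕ prependCoupling_eq_prepend ∕ ne3OfRecord₁₁ ∕ ne2OfRecord₁₁ ∕
u3OfRecord₁₁_objects`, RR-1's stage-free layer-A containers `U3Letters₁₁ ∕ U3Objects₁₁ ∕ U3Tower₁₁ ∕ NE3Objects₁₁ ∕ NE2Objects₁₁ ∕ RateObjects₁₁` of `Node00/RateRecord11`,
and the Stage-12 bundle `u3OfRecord₁₂` this file's bundle REDUCES to by `rfl`) and RR-2 g5's Stage-13 key `Node00/Record13DatumKey` (p489352: `IsDatumOfRecord₁₃CCoP`,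
`.params ∕ .provisos ∕ .admissible ∕ .eq_datumOfRecord₁₃CoP ∕ .gamma_pos ∕ .exists_world_gamma`, `isDatumOfRecord₁₃CCoP_of_isRecordOfRecord₁₃CCoP`, `isDatumOfRecord₁₃CCoP_datumOfRecord₁₃CoP`,
`RateAssignment₁₃`; brings `Node00/Record13`).  There is no Literature `Node00/RateRecord12 ∕ 13`: layer A is stage-free; the stage-typed assignment types are RR-2's.

THE DEFINITION («PINS ONLY», keyed through the DATUM KEY exactly as at ₁₁ ∕ ₁₂).  A RATE READING `𝔯 : RateReading₁₃CoP N` is the pair of RESIDUAL assignments the objects of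
record are read from, AT A STAGE-13 TUPLE WITH ITS PROVISOS (readings TAKE the provisos; RR-2's proviso-free `RateAssignment₁₃` embeds by `RateReading₁₃CoP.ofAssignment`):
`𝔯.lit F θ hP g₀ os : RateObjects₁₁ N` (node U3's objects and letter block, the single-scale layers `ne3 k`, `ne2 k`) and `𝔯.ne1 F θ hP g₀ os` (N14's dressed tower,
Summits-typed).  The bundle of RUN LENGTH `k` is `rateCarriersOfRecord₁₃CoP 𝔯 F θ hP g₀ os k` with U3 component `u3OfRecord₁₃ θ u k := ⟨u.levelCarriers k, Window θ.γ, θ.γ,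
u.κ, u.EA k, u.EB k, u.θ₅, u.C₅, u.moduli, u.C₉, u.ω, u.cr, u.ρ⟩` (`θ.γ` read through the parent projections — this IS the Stage-12 bundle of `θ.toStage12Params`,
`u3OfRecord₁₃_eq_u3OfRecord₁₂`, and the Stage-11 bundle of def-T's view `θ.toStage11 F N p` for every run `p`, `u3OfRecord₁₃_eq_toStage11`, both `rfl` — so EVERY
θ-generic Stage-11 ∕ Stage-12 slot closer over `u3OfRecord₁₁ ∕ u3OfRecord₁₂` applies verbatim), and
`RRec₁₃CoP 𝔯 F D g₀ os R :↔ ∃ (h : Node00.IsDatumOfRecord₁₃CCoP F N D) (k : ℕ), R = rateCarriersOfRecord₁₃CoP 𝔯 F h.params h.provisos g₀ os k`.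

WHAT THIS MODULE PROVES (all bookkeeping; the Stage-12 list under `12 ↦ 13`).
* §1 node U3's bundle at Stage 13 and its faces: `u3OfRecord₁₃_W ∕ _γ ∕ _Λ ∕ _C ∕ _EA ∕ _EB` (`rfl`), `u3OfRecord₁₃_eq_u3OfRecord₁₂`, `u3OfRecord₁₃_eq_toStage11` (`rfl`),
  `fadingMemory_u3OfRecord₁₃` (**`FadingMemory` BY NAME from the letter signs**), `n22At_u3OfRecord₁₃_iff` (under the signs `N22At` IS `NE9` alone), `u3OfRecord₁₃_objects`.
* §2 the reading, the bundle, the predicate and its faces: `RateReading₁₃CoP.ofAssignment(_lit ∕ _ne1)`, `rRec₁₃CoP_iff` (`Iff.rfl`), `rRec₁₃CoP_self`,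
  `RRec₁₃CoP.datumKey ∕ .stage13 ∕ .home ∕ .window ∕ .moduli ∕ .gamma_pos ∕ .ne3_L ∕ .two_le_ne3_L ∕ .other_level`, `rRec₁₃CoP_congr` (re-key tool),
  `exists_rRec₁₃CoP_of_isRecordOfRecord₁₃CCoP`.
* §3 the one-application instances: `forall_datumKey₁₃CoP_of_forall_admissible` (θ-FORM transfer), `s_N14 ∕ s_N15 ∕ s_N16 ∕ s_N17 ∕ s_N18 ∕ s_N22 ∕ s_D4_rRec₁₃CoP_iff`,
  `rateInputs_rRec₁₃CoP_iff`, `rateInputsAll_rRec₁₃CoP_iff` (K4's two hooks at the home).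
* §4 `s_R00x_rRec₁₃CoP` (K4's existence stub PROVED OUTRIGHT at `IsRecordOfRecord₁₃CCoP`: existence is free because the objects are residual), `exists_pinned_rRec₁₃CoP_of_inhabited`
  (record-pair form) and `exists_pinned_rRec₁₃CoP_of_k0` (the K0‴ LINK in the literal shape of rev 16's `Record13Inhabited` body at `N`: «`∃ θ, θ.Provisos₁₃Core F N ∧ (θ.ZtUnity F N ∧
  θ.SlotsNondegenerate₁₃ F N) ∧ θ.Admissible F N`»), `k4_rRec₁₃CoP_of_uninhabited` (honesty, hypothesis form: with NO Stage-13 datum of record anywhere the seven K4 stubs at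
  `RRec₁₃CoP 𝔯` hold with no estimate — the knit is worth exactly K0‴).

HONEST FRAMING (binding).  PINS ONLY; EVERY rate object is read from the RESIDUAL reading `𝔯` until a definer PINS it by name (node00-def-W1's reading for node U3's
functionals; N16's letters; N15's paired instances; NODE O's dressed tower → `𝔯.ne1`) — so `S_N14 … S_N22 (RRec₁₃CoP 𝔯)` are statements ABOUT `𝔯`'s objects: contentful for a
constructed `𝔯`, refutable for a junk `𝔯`; **a skeleton quoting `S_N1x (RRec₁₃CoP 𝔯)` NAMES its `𝔯`.**  Nothing of Bałaban's is asserted or instantiated; NE1′ ∕ NE2 ∕ NE3 ∕ NE4 ∕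
NE5 ∕ NE9 are NOT PRINTED for d = 4 and NOT PROVED; no inhabitant of `IsDatumOfRecord₁₃CCoP` is claimed (K0‴ `Record13Inhabited`, stmt-QuantumFields-19909, OPEN); no node is
discharged (typed 28∕28, discharged count untouched); one finite four-torus programme at fixed `ε`, Bałaban as printed — NOT ℝ⁴, NOT infinite volume, NOT OS, NOT a mass gap,
NOT Clay.  No decl below carries a cite tag.
-/

noncomputable section

namespace YMDAG.UVSplit

open Literature.MathematicalPhysics.QuantumFieldTheory.Balaban1983to89
open Literature.MathematicalPhysics.QuantumFieldTheory.Balaban1983to89.T4Continuum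
open Literature.MathematicalPhysics.QuantumFieldTheory.Balaban1983to89.T4OutputRate (Carriers Functional Window NE9 FadingMemory)
open Summit.QuantumFields.BalabanUV.T4Continuum.NE9.TowerCarriers (TowerData prepend)
open Node00 (Stage13Params datumOfRecord₁₃CoP IsRecordOfRecord₁₃CCoP IsDatumOfRecord₁₃CCoP U3Letters₁₁ U3Objects₁₁ U3Tower₁₁ NE3Objects₁₁ NE2Objects₁₁ RateObjects₁₁
  RateAssignment₁₃ prependCoupling ne3LOfRecord₁₁)

variable {N : ℕ} [NeZero N]

/-! ## §2 The Stage-13 rate reading, the bundle of record, the predicate `RRec₁₃CoP` and its faces -/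

/-- **A STAGE-13 RATE READING**: the two RESIDUAL assignments the rate carriers of record are read from, AT A STAGE-13 TUPLE WITH ITS PROVISOS — layer A's rate objects
`lit` (node U3's object tower and letter block, N16's and N15's single-scale layers per run length) and N14's dressed tower of the observable-attached run `ne1`
(Summits-typed).  Parameters of this file; pinned later BY NAME; no law assumed. -/
structure RateReading₁₃CoP (N : ℕ) [NeZero N] where
  /-- layer A's rate objects per `(F, θ, hP, g₀, os)` -/
  lit : (F : T4Family) → (θ : Stage13Params F N) → θ.Provisos₁₃Core F N → (ℕ → ℝ) → List (ULoop F) → RateObjects₁₁ N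
  /-- N14's dressed-tower carriers per `(F, θ, hP, g₀, os)` -/
  ne1 : (F : T4Family) → (θ : Stage13Params F N) → θ.Provisos₁₃Core F N → (ℕ → ℝ) → List (ULoop F) → NE1pCarriers

namespace RateReading₁₃CoP

/-- **EMBEDDING OF A PROVISO-FREE ASSIGNMENT** (RR-2's `RateAssignment₁₃`) with a proviso-free dressed-tower assignment: forget the provisos. -/
def ofAssignment (a : RateAssignment₁₃ N) (ne1 : (F : T4Family) → Stage13Params F N → (ℕ → ℝ) → List (ULoop F) → NE1pCarriers) : RateReading₁₃CoP N :=
  ⟨fun F θ _ g₀ os => a F θ g₀ os, fun F θ _ g₀ os => ne1 F θ g₀ os⟩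

/-- Its rate objects are the assignment's (`rfl`). -/
theorem ofAssignment_lit (a : RateAssignment₁₃ N) (ne1 : (F : T4Family) → Stage13Params F N → (ℕ → ℝ) → List (ULoop F) → NE1pCarriers)
    (F : T4Family) (θ : Stage13Params F N) (hP : θ.Provisos₁₃Core F N) (g₀ : ℕ → ℝ) (os : List (ULoop F)) :
    (ofAssignment a ne1).lit F θ hP g₀ os = a F θ g₀ os := rfl

/-- Its dressed-tower carriers are the assignment's (`rfl`). -/
theorem ofAssignment_ne1 (a : RateAssignment₁₃ N) (ne1 : (F : T4Family) → Stage13Params F N → (ℕ → ℝ) → List (ULoop F) → NE1pCarriers)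
    (F : T4Family) (θ : Stage13Params F N) (hP : θ.Provisos₁₃Core F N) (g₀ : ℕ → ℝ) (os : List (ULoop F)) :
    (ofAssignment a ne1).ne1 F θ hP g₀ os = ne1 F θ g₀ os := rfl

end RateReading₁₃CoP

/-- **THE STAGE-13 RATE-CARRIER BUNDLE OF RECORD AT RUN LENGTH `k`** read from `𝔯` at `(F, θ, hP, g₀, os)`. -/
def rateCarriersOfRecord₁₃CoP (𝔯 : RateReading₁₃CoP N) (F : T4Family) (θ : Stage13Params F N) (hP : θ.Provisos₁₃Core F N) (g₀ : ℕ → ℝ)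
    (os : List (ULoop F)) (k : ℕ) : RateCarriers N :=
  ⟨𝔯.ne1 F θ hP g₀ os, ne2OfRecord₁₁ ((𝔯.lit F θ hP g₀ os).ne2 k), ne3OfRecord₁₁ F ((𝔯.lit F θ hP g₀ os).ne3 k),
    u3OfRecord₁₃ θ (𝔯.lit F θ hP g₀ os).u3 k⟩

/-- **THE RATE-CARRIER PREDICATE OF RECORD, STAGE 13, KEYED BY THE DATUM**: at `(F, D, g₀, os)` it pins exactly the bundles of every run length `k` read from `𝔯` at the
CANONICAL Stage-13 parameter `h.params` of the datum of record `D` with its provisos `h.provisos` (`h : Node00.IsDatumOfRecord₁₃CCoP F N D` — a proposition: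
proof-irrelevant, one parameter). -/
def RRec₁₃CoP (𝔯 : RateReading₁₃CoP N) : RateRecordPred N :=
  fun F D g₀ os R => ∃ (h : IsDatumOfRecord₁₃CCoP F N D) (k : ℕ), R = rateCarriersOfRecord₁₃CoP 𝔯 F h.params h.provisos g₀ os k

variable (𝔯 : RateReading₁₃CoP N)

/-- Unfolding (`Iff.rfl`). -/
theorem rRec₁₃CoP_iff {F : T4Family} (D : Datum F N) (g₀ : ℕ → ℝ) (os : List (ULoop F)) (R : RateCarriers N) :
    RRec₁₃CoP 𝔯 F D g₀ os R ↔ ∃ (h : IsDatumOfRecord₁₃CCoP F N D) (k : ℕ), R = rateCarriersOfRecord₁₃CoP 𝔯 F h.params h.provisos g₀ os k :=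
  Iff.rfl

/-- **EVERY LEVEL OF THE READING AT A DATUM KEY IS PINNED AT THAT DATUM.** -/
theorem rRec₁₃CoP_self {F : T4Family} {D : Datum F N} (h : IsDatumOfRecord₁₃CCoP F N D) (g₀ : ℕ → ℝ) (os : List (ULoop F)) (k : ℕ) :
    RRec₁₃CoP 𝔯 F D g₀ os (rateCarriersOfRecord₁₃CoP 𝔯 F h.params h.provisos g₀ os k) :=
  ⟨h, k, rfl⟩

namespace RRec₁₃CoP

variable {𝔯} {F : T4Family} {D : Datum F N} {g₀ : ℕ → ℝ} {os : List (ULoop F)} {R : RateCarriers N}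

/-- The datum key and the run length behind a pinned bundle. -/
theorem datumKey (hR : RRec₁₃CoP 𝔯 F D g₀ os R) :
    ∃ (h : IsDatumOfRecord₁₃CCoP F N D) (k : ℕ), R = rateCarriersOfRecord₁₃CoP 𝔯 F h.params h.provisos g₀ os k := hR

/-- **TYPED OVER STAGE 13**: a pinned bundle comes with an admissible Stage-13 tuple with provisos realising the datum whose window bounds the bundle's radius
(`R.u3.γ ≤ θ.γ`, here `=`). -/
theorem stage13 (hR : RRec₁₃CoP 𝔯 F D g₀ os R) :
    ∃ (θ : Stage13Params F N) (hP : θ.Provisos₁₃Core F N), θ.Admissible F N ∧ D = datumOfRecord₁₃CoP F N θ hP ∧ R.u3.γ ≤ θ.γ := by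
  obtain ⟨h, k, rfl⟩ := hR
  exact ⟨h.params, h.provisos, h.admissible, h.eq_datumOfRecord₁₃CoP, le_rfl⟩

/-- **THE HOME-KEYING FACE**: a pinned bundle's datum is a Stage-13 record at a world whose window IS the bundle's radius (`Node00.IsDatumOfRecord₁₃CCoP.exists_world_gamma`). -/
theorem home (hR : RRec₁₃CoP 𝔯 F D g₀ os R) : ∃ w : DagBinding.WorldP, IsRecordOfRecord₁₃CCoP F N D w ∧ R.u3.γ = w.γ := by
  obtain ⟨h, k, rfl⟩ := hR
  obtain ⟨w, hw, hγ⟩ := h.exists_world_gamma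
  exact ⟨w, hw, hγ.symm⟩

/-- The bundle's window IS `Window R.u3.γ` (the first conjunct of the N22 ∕ N18 slots). -/
theorem window (hR : RRec₁₃CoP 𝔯 F D g₀ os R) : R.u3.W = Window R.u3.γ := by
  obtain ⟨h, k, rfl⟩ := hR
  rfl

/-- The bundle's moduli ARE `C₉·ω^{k−i}` (the analytic-slot letter clause). -/
theorem moduli (hR : RRec₁₃CoP 𝔯 F D g₀ os R) : R.u3.Λ = fun a i => R.u3.C₉ * R.u3.ω ^ (a - i) := by
  obtain ⟨h, k, rfl⟩ := hR
  rfl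

/-- The bundle's radius is positive (`0 < θ.γ` from admissibility). -/
theorem gamma_pos (hR : RRec₁₃CoP 𝔯 F D g₀ os R) : 0 < R.u3.γ := by
  obtain ⟨h, k, rfl⟩ := hR
  exact h.gamma_pos

/-- N16 ∕ N21's block-factor clause: `R.ne3.L = F.L`. -/
theorem ne3_L (hR : RRec₁₃CoP 𝔯 F D g₀ os R) : R.ne3.L = F.L := by
  obtain ⟨h, k, rfl⟩ := hR
  rfl

/-- … hence `2 ≤ R.ne3.L` (`Node00.two_le_ne3LOfRecord₁₁`). -/
theorem two_le_ne3_L (hR : RRec₁₃CoP 𝔯 F D g₀ os R) : 2 ≤ R.ne3.L := by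
  obtain ⟨h, k, rfl⟩ := hR
  exact Node00.two_le_ne3LOfRecord₁₁ F

/-- **THE TOWER KEY — EVERY OTHER RUN LENGTH OF THE SAME READING IS AGAIN A BUNDLE OF RECORD AT THE SAME DATUM** (in particular every lower level). -/
theorem other_level (hR : RRec₁₃CoP 𝔯 F D g₀ os R) (k' : ℕ) :
    ∃ (h : IsDatumOfRecord₁₃CCoP F N D), RRec₁₃CoP 𝔯 F D g₀ os (rateCarriersOfRecord₁₃CoP 𝔯 F h.params h.provisos g₀ os k') := by
  obtain ⟨h, k, rfl⟩ := hR
  exact ⟨h, h, k', rfl⟩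

end RRec₁₃CoP

/-- **THE RE-KEY TOOL**: two readings that AGREE on the admissible tuples with provisos key the same predicate (so a definer's pin is ONE pointwise equation). -/
theorem rRec₁₃CoP_congr {𝔯 𝔯' : RateReading₁₃CoP N}
    (hlit : ∀ (F : T4Family) (θ : Stage13Params F N) (hP : θ.Provisos₁₃Core F N), θ.Admissible F N → ∀ (g₀ : ℕ → ℝ) (os : List (ULoop F)),
      𝔯.lit F θ hP g₀ os = 𝔯'.lit F θ hP g₀ os)
    (hne1 : ∀ (F : T4Family) (θ : Stage13Params F N) (hP : θ.Provisos₁₃Core F N), θ.Admissible F N → ∀ (g₀ : ℕ → ℝ) (os : List (ULoop F)),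
      𝔯.ne1 F θ hP g₀ os = 𝔯'.ne1 F θ hP g₀ os)
    {F : T4Family} (D : Datum F N) (g₀ : ℕ → ℝ) (os : List (ULoop F)) (R : RateCarriers N) :
    RRec₁₃CoP 𝔯 F D g₀ os R ↔ RRec₁₃CoP 𝔯' F D g₀ os R := by
  have key : ∀ (h : IsDatumOfRecord₁₃CCoP F N D) (k : ℕ),
      rateCarriersOfRecord₁₃CoP 𝔯 F h.params h.provisos g₀ os k = rateCarriersOfRecord₁₃CoP 𝔯' F h.params h.provisos g₀ os k := fun h k => by
    unfold rateCarriersOfRecord₁₃CoP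
    rw [hlit F h.params h.provisos h.admissible g₀ os, hne1 F h.params h.provisos h.admissible g₀ os]
  constructor
  · rintro ⟨h, k, rfl⟩
    exact ⟨h, k, key h k⟩
  · rintro ⟨h, k, rfl⟩
    exact ⟨h, k, (key h k).symm⟩

/-- **AT A STAGE-13 RECORD PAIR** `(D, w)`: the datum is of record and every run length of the reading at its canonical parameter is pinned at `D`, for every `(g₀, os)`. -/
theorem exists_rRec₁₃CoP_of_isRecordOfRecord₁₃CCoP {F : T4Family} {D : Datum F N} {w : DagBinding.WorldP} (hR : IsRecordOfRecord₁₃CCoP F N D w) :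
    ∃ h : IsDatumOfRecord₁₃CCoP F N D, ∀ (g₀ : ℕ → ℝ) (os : List (ULoop F)) (k : ℕ),
      RRec₁₃CoP 𝔯 F D g₀ os (rateCarriersOfRecord₁₃CoP 𝔯 F h.params h.provisos g₀ os k) :=
  ⟨Node00.isDatumOfRecord₁₃CCoP_of_isRecordOfRecord₁₃CCoP hR, fun g₀ os k => rRec₁₃CoP_self 𝔯 _ g₀ os k⟩

/-! ## §3 The one-application instances of the K4 stubs at `RRec₁₃CoP 𝔯` -/

/-- **THE θ-FORM TRANSFER**: a property of the reading's bundles established at EVERY admissible Stage-13 parameter with provisos holds at the canonical parameter of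
every Stage-13 datum of record (how a consumer's ∀θ-theorem feeds the `iff`s below; `Node00.IsDatumOfRecord₁₃CCoP.forall_params`'s pattern). -/
theorem forall_datumKey₁₃CoP_of_forall_admissible
    {P : (F : T4Family) → Datum F N → (θ : Stage13Params F N) → θ.Provisos₁₃Core F N → (ℕ → ℝ) → List (ULoop F) → ℕ → Prop}
    (hP : ∀ (F : T4Family) (θ : Stage13Params F N) (hθ : θ.Provisos₁₃Core F N), θ.Admissible F N →
      ∀ (g₀ : ℕ → ℝ) (os : List (ULoop F)) (k : ℕ), P F (datumOfRecord₁₃CoP F N θ hθ) θ hθ g₀ os k)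
    (F : T4Family) (D : Datum F N) (h : IsDatumOfRecord₁₃CCoP F N D) (g₀ : ℕ → ℝ) (os : List (ULoop F)) (k : ℕ) :
    P F D h.params h.provisos g₀ os k := by
  have := hP F h.params h.provisos h.admissible g₀ os k
  rwa [← h.eq_datumOfRecord₁₃CoP] at this

/-- **N14 at the Stage-13 home**: `S_N14 (RRec₁₃CoP 𝔯)` IS NE1′ at the dressed tower `𝔯.ne1` read at every datum key (CONTENTFUL ONLY FOR A NAMED `𝔯.ne1`). -/
theorem s_N14_rRec₁₃CoP_iff : S_N14 (RRec₁₃CoP 𝔯) ↔ ∀ (F : T4Family) (D : Datum F N) (h : IsDatumOfRecord₁₃CCoP F N D) (g₀ : ℕ → ℝ) (os : List (ULoop F)),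
    N14At (𝔯.ne1 F h.params h.provisos g₀ os) := by
  constructor
  · intro hS F D h g₀ os
    exact hS F D g₀ os _ ⟨h, 0, rfl⟩
  · rintro hS F D g₀ os R ⟨h, k, rfl⟩
    exact hS F D h g₀ os

/-- **N15 at the Stage-13 home**: the three NE2⁺ layers at the level-`k` paired instances of the reading. -/
theorem s_N15_rRec₁₃CoP_iff : S_N15 (RRec₁₃CoP 𝔯) ↔ ∀ (F : T4Family) (D : Datum F N) (h : IsDatumOfRecord₁₃CCoP F N D) (g₀ : ℕ → ℝ) (os : List (ULoop F))
    (k : ℕ), N15At (ne2OfRecord₁₁ ((𝔯.lit F h.params h.provisos g₀ os).ne2 k)) := by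
  constructor
  · intro hS F D h g₀ os k
    exact hS F D g₀ os _ ⟨h, k, rfl⟩
  · rintro hS F D g₀ os R ⟨h, k, rfl⟩
    exact hS F D h g₀ os k

/-- **N16 at the Stage-13 home**: NE3 at the level-`k` NE3 objects of the reading with the family's block factor. -/
theorem s_N16_rRec₁₃CoP_iff : S_N16 (RRec₁₃CoP 𝔯) ↔ ∀ (F : T4Family) (D : Datum F N) (h : IsDatumOfRecord₁₃CCoP F N D) (g₀ : ℕ → ℝ) (os : List (ULoop F))
    (k : ℕ), N16At (ne3OfRecord₁₁ F ((𝔯.lit F h.params h.provisos g₀ os).ne3 k)) := by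
  constructor
  · intro hS F D h g₀ os k
    exact hS F D g₀ os _ ⟨h, k, rfl⟩
  · rintro hS F D g₀ os R ⟨h, k, rfl⟩
    exact hS F D h g₀ os k

/-- **N17 at the Stage-13 home**: NE4 ON THE DATUM at the dependent letters `(cr·C₅·θ₅, ρ, θ.γ)` of the reading's letter block (level-free: K-uniform letters). -/
theorem s_N17_rRec₁₃CoP_iff : S_N17 (RRec₁₃CoP 𝔯) ↔ ∀ (F : T4Family) (D : Datum F N) (h : IsDatumOfRecord₁₃CCoP F N D) (g₀ : ℕ → ℝ) (os : List (ULoop F))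
    (k : ℕ), N17At D (u3OfRecord₁₃ h.params (𝔯.lit F h.params h.provisos g₀ os).u3 k) := by
  constructor
  · intro hS F D h g₀ os k
    exact hS F D g₀ os _ ⟨h, k, rfl⟩
  · rintro hS F D g₀ os R ⟨h, k, rfl⟩
    exact hS F D h g₀ os k

/-- **N18 at the Stage-13 home**: NE5 at EVERY level `k` of the reading's object tower, on `]0, θ.γ]`, at the letter block's `(κ, θ₅, C₅)`. -/
theorem s_N18_rRec₁₃CoP_iff : S_N18 (RRec₁₃CoP 𝔯) ↔ ∀ (F : T4Family) (D : Datum F N) (h : IsDatumOfRecord₁₃CCoP F N D) (g₀ : ℕ → ℝ) (os : List (ULoop F))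
    (k : ℕ), N18At (u3OfRecord₁₃ h.params (𝔯.lit F h.params h.provisos g₀ os).u3 k) := by
  constructor
  · intro hS F D h g₀ os k
    exact hS F D g₀ os _ ⟨h, k, rfl⟩
  · rintro hS F D g₀ os R ⟨h, k, rfl⟩
    exact hS F D h g₀ os k

/-- **N22 at the Stage-13 home**: NE9 ∧ fading memory at EVERY level `k` of the reading's object tower — by `n22At_u3OfRecord₁₃_iff`, under the letter signs this is NE9 ALONE. -/
theorem s_N22_rRec₁₃CoP_iff : S_N22 (RRec₁₃CoP 𝔯) ↔ ∀ (F : T4Family) (D : Datum F N) (h : IsDatumOfRecord₁₃CCoP F N D) (g₀ : ℕ → ℝ) (os : List (ULoop F))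
    (k : ℕ), N22At (u3OfRecord₁₃ h.params (𝔯.lit F h.params h.provisos g₀ os).u3 k) := by
  constructor
  · intro hS F D h g₀ os k
    exact hS F D g₀ os _ ⟨h, k, rfl⟩
  · rintro hS F D g₀ os R ⟨h, k, rfl⟩
    exact hS F D h g₀ os k

/-- **(D4) at the Stage-13 home**: the β-read-out binders on the datum at every level bundle. -/
theorem s_D4_rRec₁₃CoP_iff : S_D4 (RRec₁₃CoP 𝔯) ↔ ∀ (F : T4Family) (D : Datum F N) (h : IsDatumOfRecord₁₃CCoP F N D) (g₀ : ℕ → ℝ) (os : List (ULoop F))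
    (k : ℕ), ReadOutAt D (u3OfRecord₁₃ h.params (𝔯.lit F h.params h.provisos g₀ os).u3 k) := by
  constructor
  · intro hS F D h g₀ os k
    exact hS F D g₀ os _ ⟨h, k, rfl⟩
  · rintro hS F D g₀ os R ⟨h, k, rfl⟩
    exact hS F D h g₀ os k

/-- **K4's ∃-HOOK AT THE STAGE-13 HOME**: `RateInputs (RRec₁₃CoP 𝔯) F D g₀ os` IS «`D` is a Stage-13 datum of record and SOME run length of the reading carries the six
in-edges of N19». -/
theorem rateInputs_rRec₁₃CoP_iff {F : T4Family} (D : Datum F N) (g₀ : ℕ → ℝ) (os : List (ULoop F)) :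
    RateInputs (RRec₁₃CoP 𝔯) F D g₀ os ↔
      ∃ (h : IsDatumOfRecord₁₃CCoP F N D) (k : ℕ), RatesAt D (rateCarriersOfRecord₁₃CoP 𝔯 F h.params h.provisos g₀ os k) := by
  constructor
  · rintro ⟨R, ⟨h, k, rfl⟩, hr⟩
    exact ⟨h, k, hr⟩
  · rintro ⟨h, k, hr⟩
    exact ⟨_, ⟨h, k, rfl⟩, hr⟩

/-- **K4's ∀-HOOK AT THE STAGE-13 HOME** (the hook K5's N19 reads at a per-level home, `…N22AtRateRecord11.rateInputsAll_rRec₁₁_iff`'s twin): `RateInputsAll (RRec₁₃CoP 𝔯) F D g₀ os`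
IS «at every Stage-13 datum key of `D`, EVERY run length of the reading carries the six in-edges of N19». -/
theorem rateInputsAll_rRec₁₃CoP_iff {F : T4Family} (D : Datum F N) (g₀ : ℕ → ℝ) (os : List (ULoop F)) :
    RateInputsAll (RRec₁₃CoP 𝔯) F D g₀ os ↔
      ∀ (h : IsDatumOfRecord₁₃CCoP F N D) (k : ℕ), RatesAt D (rateCarriersOfRecord₁₃CoP 𝔯 F h.params h.provisos g₀ os k) := by
  constructor
  · intro hall h k
    exact hall _ ⟨h, k, rfl⟩
  · rintro hall R ⟨h, k, rfl⟩
    exact hall h k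

/-! ## §4 K4's existence stub PROVED at the Stage-13 home; the K0‴ links; honesty -/

/-- **`S_R00x` AT THE STAGE-13 HOME, PROVED OUTRIGHT**: at every Stage-13 record the rate carriers of record EXIST under the pins for every tuned run and loop string —
witness the run-length-`0` bundle at the record's own datum key (thresholds trivial, `ForSmallCouplings.of_forall`).  Existence is FREE because the objects are residual
(located, not content). -/
theorem s_R00x_rRec₁₃CoP : S_R00x (fun F D w => IsRecordOfRecord₁₃CCoP F N D w) (RRec₁₃CoP 𝔯) := by
  intro F D w hR _ _
  obtain ⟨h, hall⟩ := exists_rRec₁₃CoP_of_isRecordOfRecord₁₃CCoP 𝔯 hR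
  exact T4ContinuumYM4Torus.ForSmallCouplings.of_forall fun g₀ os => ⟨_, hall g₀ os 0⟩

/-- **K0‴ LINK, record-pair form**: if every family carries a Stage-13 record pair `(D, w)` at `N`, the predicate pins, on every family and for every `(g₀, os, k)`, a
bundle at a Stage-13 datum of record. -/
theorem exists_pinned_rRec₁₃CoP_of_inhabited
    (hK0 : ∀ F : T4Family, ∃ (D : Datum F N) (w : DagBinding.WorldP), IsRecordOfRecord₁₃CCoP F N D w)
    (F : T4Family) (g₀ : ℕ → ℝ) (os : List (ULoop F)) (k : ℕ) :
    ∃ (D : Datum F N) (w : DagBinding.WorldP) (R : RateCarriers N), IsRecordOfRecord₁₃CCoP F N D w ∧ RRec₁₃CoP 𝔯 F D g₀ os R := by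
  obtain ⟨D, w, hR⟩ := hK0 F
  obtain ⟨h, hall⟩ := exists_rRec₁₃CoP_of_isRecordOfRecord₁₃CCoP 𝔯 hR
  exact ⟨D, w, _, hR, hall g₀ os k⟩

/-- **K0‴ LINK, in the literal shape of rev 16's `Record13Inhabited` body at `N`** («`∃ θ : Stage13Params F N, θ.Provisos₁₃Core F N ∧ (θ.ZtUnity F N ∧ θ.SlotsNondegenerate₁₃ F N)
∧ θ.Admissible F N`» on every family): the predicate then pins, on every family and for every `(g₀, os, k)`, the run-length-`k` bundle at the datum of record of such a
tuple (the guard conjunct is not read by the C key; `Node00.isDatumOfRecord₁₃CCoP_datumOfRecord₁₃CoP`). -/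
theorem exists_pinned_rRec₁₃CoP_of_k0
    (hK0 : ∀ F : T4Family, ∃ θ : Stage13Params F N, θ.Provisos₁₃Core F N ∧ (θ.ZtUnity F N ∧ θ.SlotsNondegenerate₁₃ F N) ∧ θ.Admissible F N)
    (F : T4Family) (g₀ : ℕ → ℝ) (os : List (ULoop F)) (k : ℕ) :
    ∃ (D : Datum F N) (h : IsDatumOfRecord₁₃CCoP F N D), RRec₁₃CoP 𝔯 F D g₀ os (rateCarriersOfRecord₁₃CoP 𝔯 F h.params h.provisos g₀ os k) := by
  obtain ⟨θ, hP, -, hθ⟩ := hK0 F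
  exact ⟨_, Node00.isDatumOfRecord₁₃CCoP_datumOfRecord₁₃CoP F N θ hP hθ, rRec₁₃CoP_self 𝔯 _ g₀ os k⟩

/-- **HONESTY — hypothesis form**: if NO Stage-13 datum of record exists at `N` on any family (no admissible Stage-13 tuple with provisos — the negation of K0‴'s body
with the guard dropped), the seven K4 stubs hold at `RRec₁₃CoP 𝔯` WITH NO ESTIMATE; the Stage-13 knit of the NE-side is worth exactly K0‴ (`S_R00x` is the existence side and
is proved above regardless). -/
theorem k4_rRec₁₃CoP_of_uninhabited (hno : ∀ (F : T4Family) (D : Datum F N), ¬ IsDatumOfRecord₁₃CCoP F N D) :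
    S_N14 (RRec₁₃CoP 𝔯) ∧ S_N15 (RRec₁₃CoP 𝔯) ∧ S_N16 (RRec₁₃CoP 𝔯) ∧ S_N17 (RRec₁₃CoP 𝔯) ∧ S_N18 (RRec₁₃CoP 𝔯) ∧ S_N22 (RRec₁₃CoP 𝔯) ∧ S_D4 (RRec₁₃CoP 𝔯) := by
  refine ⟨?_, ?_, ?_, ?_, ?_, ?_, ?_⟩ <;>
  · rintro F D g₀ os R ⟨h, k, -⟩
    exact absurd h (hno F D)

end YMDAG.UVSplit

end
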